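import Mathlib
import Summits.Schanuel.Schanuel.Theorems.RigidCoreMinimalCounterexampleInAclLogSector
import Summits.Schanuel.Schanuel.Theorems.RigidCoreMinimalCounterexampleInAclMateFirstFailure
import Summits.Schanuel.Schanuel.Theorems.RigidCoreMinimalCounterexampleInAclMateGrowth
import Literature.NumberTheory.Transcendental.KernelTranslatesRankTwoSectors
import Summits.Schanuel.Schanuel.Theorems.RigidCoreMinimalCounterexampleInAclAclCriterion

/-!
# Bounded sets of mates are finite, bounding the first coordinate only (stub `stub_matesLocallyFinite`)

Route `RigidCore`, crux (S*) `MinimalCounterexampleInAcl` (item stmt-Schanuel-0969), line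
`kernel-arithmetic-selection` (skeleton gen 19), Stub L, landed `--supports stmt-Schanuel-0969`.

Let `x ∈ ℂ²` be a rank-2 first failure (`x ∈ firstFailures 2`) with `x₀` transcendental, and let `y` range
over the MATES of `x` (`locusMates x`: ℚ-linearly independent tuples `y` such that `(y, e^y)` satisfies every
ℚ-polynomial relation of `(x, eˣ)`).

**Claim.** For every `R`, the mates `y` with `‖y₀‖ ≤ R` form a finite set.

**Proof.**
1. (`MateGrowth.exists_coord_expPoly`, `MateGrowth.expPoly_zeros_finite`) There is a fixed non-zero
   `m₀ ∈ ℚ[T, S]` with `m₀(e^{y₀}, y₀) = 0` for every `y` on the locus, and the zeros of the non-zero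
   exponential polynomial `s ↦ m₀(e^s, s)` in the disc `‖s‖ ≤ R` form a finite set `F₀`; so `y ↦ y₀` maps our
   set into `F₀`.
2. (`exists_mvPolynomial_of_trdeg_lt_two`) Since `trdeg ℚ(x, eˣ) < 2` there is `q ≠ 0` in `ℚ[A, B]` with
   `q(x₁, x₀) = 0`; this relation of `(x, eˣ)` transfers to the locus: `q(y₁, y₀) = 0` for all `y ∈ locusPts x`.
3. (`mate_firstFailure_voc`) A mate `y` has the same locus as `x`, so `x ∈ locusPts y` and every ℚ-relation of
   `(y, e^y)` holds at `(x, eˣ)`; if `y₀` were algebraic, its minimal polynomial (in the variable `X₀`) would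
   vanish at `(x, eˣ)`, making `x₀` algebraic. Hence `y₀` is transcendental for every mate `y`.
4. (`finite_setOf_aeval_eq_zero`) For transcendental `s` the roots `z` of `q(z, s) = 0` are finitely many, so
   each fibre `{y mate | y₀ = s}` is finite (it injects into that root set via `y ↦ y₁`); fibres over
   non-values are empty. A finite union of finite fibres over `F₀` is finite.
-/

noncomputable section

set_option linter.dupNamespace false

open Complex Set

namespace Summit.Schanuel.Schanuel.Cruxes.MinimalCounterexampleInAcl.KernelArithmeticSelection

open Literature.NumberTheory.Transcendental.KernelTranslatesRankTwo (finite_setOf_aeval_eq_zero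
  exists_mvPolynomial_of_trdeg_lt_two)

variable {n : ℕ}

/-- **A mate of a first failure inherits transcendence of each coordinate.** If `x` is a first failure,
`y` a mate of `x` and `xᵢ` is transcendental, then `yᵢ` is transcendental: `x` lies on the locus of `y`
(`mate_firstFailure_voc`), so the minimal polynomial of an algebraic `yᵢ`, read in the variable `Xᵢ`,
would vanish at `(x, eˣ)`. -/
theorem transcendental_coord_of_mem_locusMates {x y : Fin n → ℂ} (hx : x ∈ firstFailures n)
    (hy : y ∈ locusMates x) {i : Fin n} (hxi : Transcendental ℚ (x i)) : Transcendental ℚ (y i) := by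
  intro halg
  apply hxi
  obtain ⟨-, hlocus⟩ := mate_firstFailure_voc hx hy
  have hxy : x ∈ locusPts y := by
    rw [hlocus]
    exact fun _ hp => hp
  have hb : minpoly ℚ (y i) ≠ 0 := minpoly.ne_zero halg.isIntegral
  have h := hxy
    (Polynomial.aeval (MvPolynomial.X (Sum.inl i) : MvPolynomial (Fin n ⊕ Fin n) ℚ) (minpoly ℚ (y i))) (by
      rw [← Polynomial.aeval_algHom_apply, MvPolynomial.aeval_X]
      simp [minpoly.aeval])
  rw [← Polynomial.aeval_algHom_apply, MvPolynomial.aeval_X] at h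
  exact ⟨minpoly ℚ (y i), hb, by simpa using h⟩

/-- **The coordinates of every tuple on the locus of a rank-2 tuple with `trdeg ℚ(x, eˣ) < 2` satisfy a FIXED
non-zero algebraic relation** `q(y₁, y₀) = 0`, `q ∈ ℚ[A, B] ∖ 0` (the relation `q(x₁, x₀) = 0` given by
`trdeg < 2`, renamed into `ℚ[X, Y]`, lies in the relation ideal of `(x, eˣ)` and transfers to the locus). -/
theorem exists_coordRel_locusPts {x : Fin 2 → ℂ}
    (htr : Algebra.trdeg ℚ ↥(IntermediateField.adjoin ℚ (range x ∪ range (cexp ∘ x))) < (2 : Cardinal)) :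
    ∃ q : MvPolynomial (Fin 2) ℚ, q ≠ 0 ∧ ∀ y ∈ locusPts x, MvPolynomial.aeval ![y 1, y 0] q = 0 := by
  obtain ⟨q, hq0, hq⟩ :=
    exists_mvPolynomial_of_trdeg_lt_two htr (mem_adjoin_self x 1) (mem_adjoin_self x 0)
  refine ⟨q, hq0, fun y hy => ?_⟩
  -- adapted from the `htrans` block of `MateGrowth.locusPts_bounded_finite_of_special`
  set r : Fin 2 → Fin 2 ⊕ Fin 2 := ![Sum.inl 1, Sum.inl 0] with hr
  have hre : ∀ w : Fin 2 → ℂ, MvPolynomial.aeval (Sum.elim w (cexp ∘ w)) (MvPolynomial.rename r q) =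
      MvPolynomial.aeval ![w 1, w 0] q := by
    intro w
    have e : (Sum.elim w (cexp ∘ w) ∘ r) = ![w 1, w 0] := by
      funext j; fin_cases j <;> rfl
    rw [MvPolynomial.aeval_rename, e]
  have h0 : MvPolynomial.aeval (Sum.elim x (cexp ∘ x)) (MvPolynomial.rename r q) = 0 := by
    rw [hre]; exact hq
  have := hy _ h0
  rwa [hre] at this

/-- **Fibres of `y ↦ y₀` on the mates are finite.** For a first failure `x ∈ ℂ²` with `x₀` transcendental and
any `s`, the mates `y` of `x` with `y₀ = s` form a finite set: empty unless `s = y₀` for a mate `y` (then `s`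
is transcendental by `transcendental_coord_of_mem_locusMates`), in which case `y ↦ y₁` injects the fibre into
the finite root set `{z | q(z, s) = 0}` of `exists_coordRel_locusPts`. -/
theorem locusMates_fibre_finite {x : Fin 2 → ℂ} (hx : x ∈ firstFailures 2) (hx0 : Transcendental ℚ (x 0))
    (s : ℂ) : {y : Fin 2 → ℂ | y ∈ locusMates x ∧ y 0 = s}.Finite := by
  obtain ⟨q, hq0, hq⟩ := exists_coordRel_locusPts hx.2.1
  by_cases hs : ∃ y ∈ locusMates x, y 0 = s
  · obtain ⟨y₀, hy₀, rfl⟩ := hs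
    have htr : Transcendental ℚ (y₀ 0) := transcendental_coord_of_mem_locusMates hx hy₀ hx0
    refine Set.Finite.of_finite_image (f := fun y : Fin 2 → ℂ => y 1)
      ((finite_setOf_aeval_eq_zero hq0 htr).subset ?_) ?_
    · rintro _ ⟨y, ⟨hy, hy0⟩, rfl⟩
      simp only [Set.mem_setOf_eq]
      rw [← hy0]
      exact hq y hy.2
    · intro y hy y' hy' h
      funext j
      fin_cases j
      · exact hy.2.trans hy'.2.symm
      · exact h
  · push Not at hs
    refine Set.finite_empty.subset ?_
    rintro y ⟨hy, hy0⟩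
    exact (hs y hy hy0).elim

/-- **Bounded sets of mates are finite, bounding the first coordinate only** (curried form of the stub):
for a rank-2 first failure `x` with `x₀` transcendental, the mates `y` with `‖y₀‖ ≤ R` are finitely many. -/
theorem locusMates_finite_of_norm_zero_le {x : Fin 2 → ℂ} (hx : x ∈ firstFailures 2)
    (hx0 : Transcendental ℚ (x 0)) (R : ℝ) :
    {y : Fin 2 → ℂ | y ∈ locusMates x ∧ ‖y 0‖ ≤ R}.Finite := by
  obtain ⟨m, hm0, hm⟩ := MateGrowth.exists_coord_expPoly hx.2.1 0
  have hF : {s : ℂ | ‖s‖ ≤ R ∧ MvPolynomial.aeval ![cexp s, s] m = 0}.Finite :=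
    MateGrowth.expPoly_zeros_finite hm0 R
  refine (hF.biUnion fun s _ => locusMates_fibre_finite hx hx0 s).subset ?_
  intro y hy
  exact Set.mem_biUnion (x := y 0) ⟨hy.2, hm y hy.1.2⟩ ⟨hy.1, rfl⟩

/-- **Registered stub `stub_matesLocallyFinite` (Stub L, PROVED)** — BOUNDED SETS OF MATES ARE FINITE, first
coordinate only (rank 2): for a rank-2 first failure `x` with `x₀` transcendental, the mates `y` with
`‖y₀‖ ≤ R` are finitely many. -/
theorem stub_matesLocallyFinite : ∀ (x : Fin 2 → ℂ), x ∈ Summit.Schanuel.Schanuel.Cruxes.MinimalCounterexampleInAcl.KernelArithmeticSelection.firstFailures 2 → Transcendental ℚ (x 0) → ∀ R : ℝ, Set.Finite {y : Fin 2 → ℂ | y ∈ Summit.Schanuel.Schanuel.Cruxes.MinimalCounterexampleInAcl.KernelArithmeticSelection.locusMates x ∧ ‖y 0‖ ≤ R} := by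
  intro x hx hx0 R
  exact locusMates_finite_of_norm_zero_le hx hx0 R

end Summit.Schanuel.Schanuel.Cruxes.MinimalCounterexampleInAcl.KernelArithmeticSelection

end
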